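import Summits.BirchSwinnertonDyer.Rank1Residual.Additive.TameBranchOfTwistBranchMult
import Summits.BirchSwinnertonDyer.Rank1Residual.Additive.TameBranchKatoDivisibilityOfKato
import Summits.BirchSwinnertonDyer.Rank1Residual.AdditivePotMult.PotMultRankOneWuthrichCertificate
import HarnessLib

/-!
# The typed Kato half `TameBranchRatDvdAt W p` on the (M) rows — X4(M) ∩ {ρ̄ onto} and X3♯(M), EVERY
# odd `p` — DERIVED FROM KATO 2004 Thm. 17.4 (3) / WUTHRICH 2014 Thm. 16, without Delbourgo 2002 (C)
# (sub-cell additive-p2, gen 22; the (M) twin of `TameBranchKatoDivisibilityOfKato.lean`, over the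
# AdditivePotMult bricks of n1011-p17 / p07)

HONEST FRAMING (cell `b2b-bsdres`, run/shared/lean/b2b/bsd-rank1-residual/, verbatim in every
file): the goal of the cell is to DELETE the COMBINATION-SHAPED residual classes of the
Birch–Swinnerton-Dyer formula for ALL analytic-rank `≤ 1` elliptic curves over `ℚ` — "full BSD
formula for every rank `≤ 1` curve in class `C`" assembled STRICTLY from published theorems — so
that the rank-`≤ 1` remainder becomes exactly the CONSTRUCTION-SHAPED classes, which are TYPED
(missing-input `Prop`s), NOT attempted. This is not "finishing BSD". Research route: labels UNCHANGED,
NOTHING booked; theorems only (no definition, no named fact); every published input is an explicit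
named-fact binder (`hK` = `Wuthrich2014.kato_halfEigenCharIdeal_dvd_cyclotomicPrime_of_surjective`,
`hWu` = `Wuthrich2014.thm16_halfEigenCharIdeal_dvd_cyclotomicPrime`, `hmodD` = BCDT parametrisations).

## What

`TameBranchRatDvdAt W p` (gen 20: the Kato-direction half of the rational tame-branch main conjecture,
typed on the whole potentially-ordinary locus `PotMult W p ∨ TypeGOrd W p`) was discharged from A227
(Delbourgo 2002 (C)) everywhere and, this generation, from Kato / Wuthrich on the (G-ord, `e = 2`) rows
(`TameBranchKatoDivisibilityOfKato.lean`). THIS FILE does the (M) rows (`E = E♭ ⊗ χ_{p*}`, `E♭`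
MULTIPLICATIVE at `p`, Kodaira `I_n*`), at EVERY odd `p`:

* `exists_mem_iota_eq_C_pow_mul_of_isTameBranchOf_of_iota_eq_plusBranchMult` / `…_minusBranchMult`
  (model level, one parity each): ONE identity `ι g₁ = C(v)·L^±_p(g, a_p, ω^{(p−1)/2}, T)` (the shape
  of the (M) bricks) ⟹ `p^k·B ∈ ι(I)` for EVERY tuple `(ε, α, B)` of the package for `f = f_E` —
  the (M) dictionary (`TameBranchOfTwistBranchMult.lean`) + gen 21's tuple rigidity + §1 of the
  G-ord file (`exists_mem_iwasawaToPowerSeries_eq_C_pow_mul`);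
* `isTorsion_and_exists_mem_iota_eq_C_pow_mul_of_multBrick` (both parities and both signs `a_p = ±1`
  glued against the native shape of the AdditivePotMult bricks `isTorsion_and_exists_iota_eq_of_katoHalf`
  / `…_of_wuthrichHalf`: `B₀` in the three-way reduction disjunction, period ratio positive);
* **`tameBranchRatDvdAt_of_classX4M_of_katoHalf`** (X4(M) ∩ {ρ̄_{E,p} onto}, every odd `p`: `hK`,
  `hmodD`; twist model `ClassX4M.exists_mult_pStar_twist_model`, tower `PotMult.towerSurj_twist_of_surj`)
  and **`tameBranchRatDvdAt_of_classX3M_of_wuthrichHalf`** (X3♯(M), every odd `p`: `hWu`, `hmodD`;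
  `E♭[p]` reducible by `irr_iff_of_model_twist`).

So on ALL defect-2 rows of N10 ((M) ∪ (G-ord, `e = 2`)) the typed Kato half is a theorem of Kato 2004 /
Wuthrich 2014 + BCDT, independent of A227 and of `Del02-KKT-inprep`. What is NOT claimed: defect
`3,4,6`; `μ`; any booking. Labels UNCHANGED.

References: [Kato2004Asterisque] Thm. 17.4 (3); [Wuthrich2014] Thm. 16, Cor. 19, Lemma 20;
[MazurTateTeitelbaum1986Invent] §I.10 (10.1), §I.13–I.14; [Delbourgo1998] hypothesis (M) p. 133;
`AdditivePotMult/PotMultRankOne{Kato,Wuthrich}Certificate.lean` (n1011-p17 / p07),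
`AdditivePotMult/PStarTwistModel.lean`, `Additive/SemistableTwistTowerThree.lean`.
-/

noncomputable section

open scoped Classical MatrixGroups ModularForm NumberField

open CongruenceSubgroup WeierstrassCurve NumberField Literature.NumberTheory.EllipticCurves
  Literature.NumberTheory.EllipticCurves.ModularForms
  Literature.NumberTheory.EllipticCurves.Rank1Residual
  Literature.NumberTheory.EllipticCurves.Rank1Residual.Typed
  Literature.NumberTheory.GaloisRepresentations
  Summit.BirchSwinnertonDyer.Rank1Residual.AdditivePotMult
  IsDedekindDomain

namespace Summit.BirchSwinnertonDyer.Rank1Residual.Additive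

section Mult

variable {W : WeierstrassCurve ℚ} [W.IsElliptic] [W.IsGloballyMinimal] {p : ℕ} [hp : Fact p.Prime]

omit [W.IsGloballyMinimal] in
/-- `a_p(g) = ap` read off `IsNewformOf V g` is `V.LFunction p`, hence `±1` at a multiplicative prime.
[folklore] -/
theorem eq_one_or_eq_neg_one_of_cuspCoeff_eq_of_mult (V : WeierstrassCurve ℚ) [V.IsElliptic]
    (hV : Mult V p) {N' : ℕ} [NeZero N'] {g : CuspForm (Gamma0 N') 2} (hg : IsNewformOf V g)
    {ap : ℤ} (hap : cuspCoeff g p = ap) : (ap = 1 ∨ ap = -1) ∧ p ∣ N' := by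
  obtain ⟨hap1, hpN⟩ := LFunction_eq_or_eq_neg_and_dvd_level_of_mult V hV hg
  have h : ((V.LFunction p : ℤ) : ℂ) = (ap : ℂ) := (hg.2 p).symm.trans hap
  have h' : V.LFunction p = ap := by exact_mod_cast h
  exact ⟨h' ▸ hap1, hpN⟩

omit [W.IsGloballyMinimal] in
/-- **Core step on (M), model level, even branch (`p ≡ 1 (mod 4)`).** `E = W` additive at `p`,
`V = E♭` MULTIPLICATIVE at `p` with `C • V^{(p)} = W`, `g` the newform of `V` with `a_p(g) = ap`, `f`
the newform of `W`; ONE identity `ι g₁ = C(v)·L⁺_p(g, ap, ω^{(p−1)/2}, T)` (`g₁ ∈ I`, `v ≠ 0`) ⟹ for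
EVERY tuple `(ε, α, B)` of the package `IsTameBranchOf f p ε α B`: `ι g' = p^k·B` for some `g' ∈ I`
(the (M) dictionary `isTameBranchOf_legendre_C_mul_padicLFunctionPlusBranchMult` + tuple rigidity +
exponent bookkeeping). [cite: MazurTateTeitelbaum1986Invent, §I.10 (10.1) with ε(p) = 0 and §I.13–I.14] -/
theorem exists_mem_iota_eq_C_pow_mul_of_isTameBranchOf_of_iota_eq_plusBranchMult (hp4 : p % 4 = 1)
    (V : WeierstrassCurve ℚ) [V.IsElliptic]
    (hVW : ∃ C : VariableChange ℚ, C • V.quadraticTwist (p : ℚ) = W) (hadd : Addv W p)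
    (hV : Mult V p) {N N' : ℕ} [NeZero N] [NeZero N'] {f : CuspForm (Gamma0 N) 2}
    {g : CuspForm (Gamma0 N') 2} (hf : IsNewformOf W f) (hg : IsNewformOf V g)
    {ap : ℤ} (hap : cuspCoeff g p = ap)
    {I : Ideal (IwasawaAlgebra p)} {g₁ : IwasawaAlgebra p} (hg₁ : g₁ ∈ I) {v : ℚ_[p]} (hv : v ≠ 0)
    (hι : iwasawaToPowerSeries p g₁ =
      PowerSeries.C v * padicLFunctionPlusBranchMult g ((ap : ℤ) : ℚ_[p]) (p / 2))
    {ε : DirichletCharacter ℂ_[p] p} {α : ℚ_[p]} {B : PowerSeries ℚ_[p]}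
    (hB : IsTameBranchOf f p ε α B) :
    ∃ g' ∈ I, ∃ k : ℕ, iwasawaToPowerSeries p g' = PowerSeries.C ((p : ℚ_[p]) ^ k) * B := by
  have hp2 : p ≠ 2 := (ne_two_and_legendreSym_neg_one_of_mod_four_eq_one (p := p) hp4).1
  obtain ⟨c, hrel⟩ := exists_legendreTwistPlusRel_of_twist hp4 V W hVW hadd hf hg
  obtain ⟨hap1, hpN⟩ := eq_one_or_eq_neg_one_of_cuspCoeff_eq_of_mult V hV hg hap
  have hdict := isTameBranchOf_legendre_C_mul_padicLFunctionPlusBranchMult hp2 hg.1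
    hg.coeffField_eq_bot hpN hap hap1 hrel
  by_cases hB0 : B = 0
  · refine ⟨0, I.zero_mem, 0, ?_⟩
    rw [hB0, map_zero, mul_zero]
  · obtain ⟨-, -, hBeq⟩ := hB.tuple_eq hp2 hdict hB0
      (norm_intCast_eq_one_of_eq_one_or_eq_neg_one (p := p) hap1).2
    obtain ⟨g', hg', k, hk⟩ := exists_mem_iwasawaToPowerSeries_eq_C_pow_mul hg₁ hv hι (c : ℚ_[p])
    exact ⟨g', hg', k, by rw [hk, hBeq]⟩

omit [W.IsGloballyMinimal] in
/-- **Core step on (M), model level, odd branch (`p ≡ 3 (mod 4)`)**: the same with `C • V^{(−p)} = W`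
and `L⁻_p(g, ap, ω^{(p−1)/2}, T)` (`isTameBranchOf_legendre_C_mul_padicLFunctionMinusBranchMult`).
[cite: MazurTateTeitelbaum1986Invent, §I.10 (10.1) with ε(p) = 0 and §I.13–I.14] -/
theorem exists_mem_iota_eq_C_pow_mul_of_isTameBranchOf_of_iota_eq_minusBranchMult (hp4 : p % 4 = 3)
    (V : WeierstrassCurve ℚ) [V.IsElliptic]
    (hVW : ∃ C : VariableChange ℚ, C • V.quadraticTwist (-(p : ℚ)) = W) (hadd : Addv W p)
    (hV : Mult V p) {N N' : ℕ} [NeZero N] [NeZero N'] {f : CuspForm (Gamma0 N) 2}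
    {g : CuspForm (Gamma0 N') 2} (hf : IsNewformOf W f) (hg : IsNewformOf V g)
    {ap : ℤ} (hap : cuspCoeff g p = ap)
    {I : Ideal (IwasawaAlgebra p)} {g₁ : IwasawaAlgebra p} (hg₁ : g₁ ∈ I) {v : ℚ_[p]} (hv : v ≠ 0)
    (hι : iwasawaToPowerSeries p g₁ =
      PowerSeries.C v * padicLFunctionMinusBranchMult g ((ap : ℤ) : ℚ_[p]) (p / 2))
    {ε : DirichletCharacter ℂ_[p] p} {α : ℚ_[p]} {B : PowerSeries ℚ_[p]}
    (hB : IsTameBranchOf f p ε α B) :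
    ∃ g' ∈ I, ∃ k : ℕ, iwasawaToPowerSeries p g' = PowerSeries.C ((p : ℚ_[p]) ^ k) * B := by
  have hp2 : p ≠ 2 := (ne_two_and_legendreSym_neg_one_of_mod_four_eq_three (p := p) hp4).1
  obtain ⟨c, hrel⟩ := exists_legendreTwistMinusRel_of_twist hp4 V W hVW hadd hf hg
  obtain ⟨hap1, hpN⟩ := eq_one_or_eq_neg_one_of_cuspCoeff_eq_of_mult V hV hg hap
  have hdict := isTameBranchOf_legendre_C_mul_padicLFunctionMinusBranchMult hp2 hg.1
    hg.coeffField_eq_bot hpN hap hap1 hrel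
  by_cases hB0 : B = 0
  · refine ⟨0, I.zero_mem, 0, ?_⟩
    rw [hB0, map_zero, mul_zero]
  · obtain ⟨-, -, hBeq⟩ := hB.tuple_eq hp2 hdict hB0
      (norm_intCast_eq_one_of_eq_one_or_eq_neg_one (p := p) hap1).2
    obtain ⟨g', hg', k, hk⟩ := exists_mem_iwasawaToPowerSeries_eq_C_pow_mul hg₁ hv hι (c : ℚ_[p])
    exact ⟨g', hg', k, by rw [hk, hBeq]⟩

omit [W.IsGloballyMinimal] in
/-- **Both parities and both signs glued, model level, against the NATIVE shape of the (M) bricks.**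
`W` additive at the odd `p`, `V = E♭` globally minimal MULTIPLICATIVE at `p` with `C • V^{(p*)} = W`,
`f` the newform of `W`, `Dm` parametrisation data of `V`, `D` a cyclotomic dual datum of
`Sel_{p^∞}(W/ℚ_∞)`; suppose the brick holds for `D` in the form of
`AdditivePotMult.isTorsion_and_exists_iota_eq_of_katoHalf` / `…_of_wuthrichHalf` (for every `B₀` in the
three-way reduction disjunction and every period ratio `ϖ` of the parity of `(p−1)/2`: torsion and
`ι g = C(u·ϖ)·B₀`). Then for EVERY tuple `(ε, α, B)` of the package for `f`: `X` is torsion and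
`p^k·B ∈ ι(char_Λ X)` (split: `a_p = 1`; non-split: `a_p = −1`; `p ≡ 1`: plus branch; `p ≡ 3`: minus).
[cite: MazurTateTeitelbaum1986Invent, §I.10 (10.1) with ε(p) = 0 and §I.13–I.14] -/
theorem isTorsion_and_exists_mem_iota_eq_C_pow_mul_of_multBrick (hp2 : p ≠ 2)
    (V : WeierstrassCurve ℚ) [V.IsElliptic] [V.IsGloballyMinimal] (C : VariableChange ℚ)
    (hC : C • V.quadraticTwist ((-1 : ℚ) ^ (p / 2) * p) = W) (hadd : Addv W p) (hV : Mult V p)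
    {N N' : ℕ} [NeZero N] [NeZero N'] {f : CuspForm (Gamma0 N) 2} (hf : IsNewformOf W f)
    (Dm : ModularParametrizationData V N')
    {κ : ZpExtension ℚ p} {γ : Field.absoluteGaloisGroup ℚ} {D : W.SelmerDualData κ γ}
    (hbrick : ∀ B₀ : PowerSeries ℚ_[p],
      ((IsOrdinaryAt V p ∧
          B₀ = if Even (p / 2) then padicLFunctionBranch Dm.f ((unitRoot V p : ℤ_[p]) : ℚ_[p]) (p / 2)
            else padicLFunctionMinusBranch Dm.f ((unitRoot V p : ℤ_[p]) : ℚ_[p]) (p / 2)) ∨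
        (V.HasSplitMultiplicativeReductionAtPrime p ∧
          B₀ = if Even (p / 2) then padicLFunctionPlusBranchMult Dm.f (1 : ℚ_[p]) (p / 2)
            else padicLFunctionMinusBranchMult Dm.f (1 : ℚ_[p]) (p / 2)) ∨
        (V.HasMultiplicativeReductionAtPrime p ∧ ¬ V.HasSplitMultiplicativeReductionAtPrime p ∧
          B₀ = if Even (p / 2) then padicLFunctionPlusBranchMult Dm.f (-1 : ℚ_[p]) (p / 2)
            else padicLFunctionMinusBranchMult Dm.f (-1 : ℚ_[p]) (p / 2))) →
      ∀ ϖ : ℚ, (if Even (p / 2) then (ϖ : ℝ) * V.realPeriodRat = plusPeriod Dm.f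
          else (ϖ : ℝ) * V.imaginaryPeriodRat = minusPeriod Dm.f) →
        D.IsTorsion ∧ ∃ g ∈ D.charIdeal, ∃ u : ℤ_[p]ˣ,
          iwasawaToPowerSeries p g = PowerSeries.C (((u : ℤ_[p]) : ℚ_[p]) * (ϖ : ℚ_[p])) * B₀)
    {ε : DirichletCharacter ℂ_[p] p} {α : ℚ_[p]} {B : PowerSeries ℚ_[p]}
    (hB : IsTameBranchOf f p ε α B) :
    D.IsTorsion ∧ ∃ g' ∈ D.charIdeal, ∃ k : ℕ,
      iwasawaToPowerSeries p g' = PowerSeries.C ((p : ℚ_[p]) ^ k) * B := by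
  have hodd : p % 4 = 1 ∨ p % 4 = 3 := by
    obtain ⟨k, hk⟩ := hp.out.odd_of_ne_two hp2
    omega
  -- the sign `a_p(E♭) = ±1` and the corresponding brick series
  have hsign : ∃ ap : ℤ, cuspCoeff Dm.f p = ap ∧ ∀ ϖ : ℚ,
      (if Even (p / 2) then (ϖ : ℝ) * V.realPeriodRat = plusPeriod Dm.f
        else (ϖ : ℝ) * V.imaginaryPeriodRat = minusPeriod Dm.f) →
      D.IsTorsion ∧ ∃ g ∈ D.charIdeal, ∃ u : ℤ_[p]ˣ,
        iwasawaToPowerSeries p g = PowerSeries.C (((u : ℤ_[p]) : ℚ_[p]) * (ϖ : ℚ_[p])) *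
          (if Even (p / 2) then padicLFunctionPlusBranchMult Dm.f ((ap : ℤ) : ℚ_[p]) (p / 2)
            else padicLFunctionMinusBranchMult Dm.f ((ap : ℤ) : ℚ_[p]) (p / 2)) := by
    by_cases hs : V.HasSplitMultiplicativeReductionAtPrime p
    · refine ⟨1, (Dm.isNewformOf.cuspCoeff_eq_one_and_sq_of_split hs).1.trans (by norm_num),
        fun ϖ hϖ ↦ ?_⟩
      simpa only [Int.cast_one] using hbrick _ (Or.inr (Or.inl ⟨hs, rfl⟩)) ϖ hϖ
    · refine ⟨-1, (Dm.isNewformOf.cuspCoeff_eq_neg_one_and_dvd_of_nonsplit hV hs).1.trans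
        (by norm_num), fun ϖ hϖ ↦ ?_⟩
      simpa only [Int.cast_neg, Int.cast_one] using hbrick _ (Or.inr (Or.inr ⟨hV, hs, rfl⟩)) ϖ hϖ
  obtain ⟨ap, hap, hb⟩ := hsign
  rcases hodd with h1 | h3
  · have heven : Even (p / 2) := ⟨p / 4, by omega⟩
    obtain ⟨ϖ, hϖ0, hϖ, -⟩ := Dm.exists_rat_mul_realPeriodRat_eq_plusPeriod
    obtain ⟨hXt, g₁, hg₁, u, hι⟩ := hb ϖ (by rw [if_pos heven]; exact hϖ)
    rw [if_pos heven] at hι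
    have hC' : C • V.quadraticTwist (p : ℚ) = W := by
      rw [pStar_eq_of_mod_four p (Or.inl h1), if_pos h1] at hC
      exact hC
    have hv : (((u : ℤ_[p]) : ℚ_[p]) * (ϖ : ℚ_[p])) ≠ 0 :=
      mul_ne_zero (PadicInt.coe_ne_zero.mpr u.ne_zero) (by exact_mod_cast hϖ0.ne')
    exact ⟨hXt, exists_mem_iota_eq_C_pow_mul_of_isTameBranchOf_of_iota_eq_plusBranchMult h1 V
      ⟨C, hC'⟩ hadd hV hf Dm.isNewformOf hap hg₁ hv hι hB⟩
  · have hnot : ¬ Even (p / 2) := by rw [Nat.not_even_iff_odd]; exact ⟨p / 4, by omega⟩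
    obtain ⟨ϖ, hϖ0, hϖ⟩ := exists_rat_mul_imaginaryPeriodRat_eq_minusPeriod Dm
    obtain ⟨hXt, g₁, hg₁, u, hι⟩ := hb ϖ (by rw [if_neg hnot]; exact hϖ)
    rw [if_neg hnot] at hι
    have hC' : C • V.quadraticTwist (-(p : ℚ)) = W := by
      rw [pStar_eq_of_mod_four p (Or.inr h3), if_neg (by omega)] at hC
      exact hC
    have hv : (((u : ℤ_[p]) : ℚ_[p]) * (ϖ : ℚ_[p])) ≠ 0 :=
      mul_ne_zero (PadicInt.coe_ne_zero.mpr u.ne_zero) (by exact_mod_cast hϖ0.ne')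
    exact ⟨hXt, exists_mem_iota_eq_C_pow_mul_of_isTameBranchOf_of_iota_eq_minusBranchMult h3 V
      ⟨C, hC'⟩ hadd hV hf Dm.isNewformOf hap hg₁ hv hι hB⟩

/-- **X4(M) ∩ {`ρ̄_{E,p}` onto}, EVERY odd `p` (`p = 3` included): the typed Kato half
`TameBranchRatDvdAt W p` is a THEOREM of Kato 2004 Thm. 17.4 (3)** (half-eigenspace reading `hK`)
and BCDT parametrisations (`hmodD`) — NO Delbourgo 2002 (C), no `Del02-KKT-inprep`, no `5 ≤ p`.
Chain: `ClassX4M.exists_mult_pStar_twist_model`, `PotMult.towerSurj_twist_of_surj` (surj(p) of `E`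
up the tower of `E♭`, Wuthrich Lemma 20 multiplicative case), n1011-p17's brick
`AdditivePotMult.isTorsion_and_exists_iota_eq_of_katoHalf`, and
`isTorsion_and_exists_mem_iota_eq_C_pow_mul_of_multBrick`.
[cite: Kato2004Asterisque, Thm. 17.4 (3) (p. 273)] [cite: Wuthrich2014, Lemma 20 (p. 399)]
[cite: MazurTateTeitelbaum1986Invent, §I.13–I.14] -/
theorem tameBranchRatDvdAt_of_classX4M_of_katoHalf
    (hK : Wuthrich2014.kato_halfEigenCharIdeal_dvd_cyclotomicPrime_of_surjective)
    (hmodD : nonempty_modularParametrizationData)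
    (hX : ClassX4M W p) (hsurj : Surj W p) : TameBranchRatDvdAt W p := by
  intro κ γ N _ f ε α B hp2 hadd _ hκ hγ hcv hf _ _ hB D
  obtain ⟨V, iV, iVm, C, hV, hC⟩ := hX.exists_mult_pStar_twist_model
  haveI : NeZero (V.conductorNorm ℤ) := ⟨(V.conductorNorm_pos_holds).ne'⟩
  obtain ⟨Dm⟩ := hmodD V
  have hsurjV : ∀ n : ℕ, V.HasSurjectiveModNGaloisRep (p ^ n : ℕ) :=
    (ClassX4M.potMult W p hX).towerSurj_twist_of_surj hp2 hsurj V C hC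
  exact isTorsion_and_exists_mem_iota_eq_C_pow_mul_of_multBrick hp2 V C hC hadd hV hf Dm
    (fun B₀ hdisj ϖ hϖ ↦ isTorsion_and_exists_iota_eq_of_katoHalf hK hp2 V C hC hsurjV hκ hγ hcv
      Dm.isNewformOf D B₀ hdisj ϖ hϖ) hB

/-- **X3♯(M), EVERY odd `p`: `TameBranchRatDvdAt W p` is a THEOREM of Wuthrich 2014 Thm. 16**
(half-eigenspace reading `hWu`) and `hmodD` — NO image hypothesis, NO Delbourgo 2002 (C). Chain:
`ClassX3M.exists_mult_pStar_twist_model`, `E♭[p]` reducible (`irr_iff_of_model_twist`), p07's brick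
`AdditivePotMult.isTorsion_and_exists_iota_eq_of_wuthrichHalf`, and the glue above.
[cite: Wuthrich2014, Thm. 16 (p. 397)] [cite: MazurTateTeitelbaum1986Invent, §I.13–I.14] -/
theorem tameBranchRatDvdAt_of_classX3M_of_wuthrichHalf
    (hWu : Wuthrich2014.thm16_halfEigenCharIdeal_dvd_cyclotomicPrime)
    (hmodD : nonempty_modularParametrizationData) (hX : ClassX3M W p) : TameBranchRatDvdAt W p := by
  intro κ γ N _ f ε α B hp2 hadd _ hκ hγ hcv hf _ _ hB D
  obtain ⟨V, iV, iVm, C, hV, hC⟩ := hX.exists_mult_pStar_twist_model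
  haveI : NeZero (V.conductorNorm ℤ) := ⟨(V.conductorNorm_pos_holds).ne'⟩
  obtain ⟨Dm⟩ := hmodD V
  have hirrV : ¬ V.HasIrreducibleModPGaloisRep p := fun hVirr ↦
    hX.classX3.1 ((irr_iff_of_model_twist (W := V) (p := p) (pStar_ne_zero p) ⟨C, hC⟩).mpr hVirr)
  exact isTorsion_and_exists_mem_iota_eq_C_pow_mul_of_multBrick hp2 V C hC hadd hV hf Dm
    (fun B₀ hdisj ϖ hϖ ↦ isTorsion_and_exists_iota_eq_of_wuthrichHalf hWu hp2 V C hC hirrV hκ hγ hcv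
      Dm.isNewformOf D B₀ hdisj ϖ hϖ) hB

end Mult

end Summit.BirchSwinnertonDyer.Rank1Residual.Additive

end
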